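import Mathlib
import Summits.CriticalPhenomena.PercolationContinuityZ3.Theorems.PercNearOneGluingAdditiveGluingKnThm2GoodAux
import Summits.CriticalPhenomena.PercolationContinuityZ3.Theorems.PercNearOneGluingAdditiveGluingKnThm2GoodEvents
import Summits.CriticalPhenomena.PercolationContinuityZ3.Theorems.PercNearOneGluingAdditiveGluingBhkSets
import HarnessLib

/-! # `NoHeavyLowerTail` (stmt-CriticalPhenomena-4575) — the THREE-ROW reduction of Kozma–Nitzan's
# Question 7 at `|A| = 3` (new-inequality factory, prove seat #5)

Support file (`--supports stmt-CriticalPhenomena-4575`); no definitions, no named facts, no sorries.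

Kozma–Nitzan (arXiv:2401.12397, Theorem 2, pp. 8–9) prove the pre-FKG inequality (3) for three relays
`A = {a₁,a₂,a₃}`, `a₃` least `b`-reliable, ONLY in the regime `m₃ ≤ m₁₂` (`m_T = μ(C(b) ∩ A = T)`): their six
van den Berg–Häggström–Kahn steps give `X := μ(o↔A, o↔b) − μ(o↔A, a₃↔b) ≥ φ₁₂(m₁₂−m₃) + φ₁(m₁−m₂₃) + φ₂(m₂−m₁₃)`
and Lemma 2 (`φ₁₂ ≥ φ₁ + φ₂`) closes only when `m₁₂ ≥ m₃`.  The general case (their Question 7 at `|A| = 3`)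
is obstructed for every product-multiplier certificate over the presently proved inequality families
(ttrl2 wf3lp pseudo-laws, run/shared/lean/ttrl/wf3lp/README.md).  The new-inequality factory isolated three
CONJECTURED rows (ineq-harness ids P5-CIPSI, P5-L4B, P5-L3B; memo run/shared/lean/prim/prim-ineq-prove-5/TOT3-SPLIT.md;
census: 0 violations on all n ≤ 6 supports × the tot3 weight families (kit j055628, 700 990 instances each) and
0 / 0.5–1.1 M in the harness standard screens; each is negative on every surviving `(U_1)_3` pseudo-law), with
`M = {a₁,a₂,a₃ pairwise separated}`, `N₁ = {a₁↮a₂,a₃}`, `N₂`, `N₁₂ = {a₁,a₂ ↮ a₃}`: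
* (CI-ψ)  `μ(M)·(I₁ − I₂) ≥ μ(M ∩ {o↔a₁ ∨ o↔a₂})·(m₁₂ − m₃)`,
* (L4b)   `μ(M)·(A₁ m₂₃ − P₁ U₁) ≥ (μ(M ∩ {o↔a₁}) P₁ − A₁ μ(M))·(m₃ − m₁₂)`,
* (L3b)   the mirror image with `a₁ ↔ a₂`,
where `I₁ = T₁₂, I₂ = U₁₂, T₁, U₁, T₂, U₂` are KN's six pieces (`X = (T₁₂−U₁₂)+(T₁−U₁)+(T₂−U₂)`, tree:
`stub_knThm2GoodSplit`), `Pₖ = μ(Nₖ)`, `Aₖ = μ(Nₖ ∩ {aₖ↔o})`.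
THIS FILE PROVES (kernel-checked, no regime hypothesis): the three rows, together with the tree's set-BHK
theorem (`stub_bhkSets`, BHK 2006 Thms. 1.3/1.4) and `μ(M) > 0`, imply KN's Question 7 at `|A| = 3`
(`knQ7_three_of_tot3Rows`) and hence three-relay event gluing with constant 1 in E-form
(`eventGluing_three_of_tot3Rows`).  The arithmetic (`tot3Rows_arith`): from BHK `A₁m₁ ≤ P₁T₁` and (L4b),
`μ(M)(T₁−U₁) ≥ μ(M∩{o↔a₁})(m₃−m₁₂)` using `(m₁+m₁₂) − (m₃+m₂₃) = τ₁ − τ₃ ≥ 0`; symmetrically for `a₂`;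
(CI-ψ) and `μ(M∩{o↔a₁∨o↔a₂}) = μ(M∩{o↔a₁}) + μ(M∩{o↔a₂})` (disjoint under `M`) then give `μ(M)·X ≥ 0`.
So the three rows are exactly what is missing for KN Q7 at three relays; their proofs are open.
[cite: KozmaNitzan2024, Theorem 2 (§3.2, pp. 8–9) and Question 7 (§5.5, p. 36); VandenbergHaggstromKahn2005, Thms. 1.3–1.4]
-/

namespace Summit.CriticalPhenomena.PercolationContinuityZ3.Theorems

open MeasureTheory Set Literature.Probability.LatticeModels Literature.Probability.Percolation

noncomputable section
open Classical

variable {n : ℕ}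

namespace TOT3Rows

/-- **Real-arithmetic core of the three-row reduction.**  From the BHK steps `A₁ m₁ ≤ P₁ T₁`,
`A₂ m₂ ≤ P₂ T₂`, the rows (CI-ψ), (L4b), (L3b), `A_M = A₁M + A₂M`, `μ(M) ≤ P₁, P₂`, `μ(M) > 0` and the
worst-relay relations `m₃ + m₂₃ ≤ m₁ + m₁₂`, `m₃ + m₁₃ ≤ m₂ + m₁₂`:  `0 ≤ (T₁₂ − U₁₂) + (T₁ − U₁) + (T₂ − U₂)`.
[this file] -/
theorem tot3Rows_arith {T₁₂ U₁₂ T₁ U₁ T₂ U₂ P₁ P₂ PM A₁ A₂ A₁M A₂M AM m₁₂ m₃ m₁ m₂₃ m₂ m₁₃ : ℝ}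
    (hPM : 0 < PM) (hP1 : PM ≤ P₁) (hP2 : PM ≤ P₂) (hA1 : 0 ≤ A₁) (hA2 : 0 ≤ A₂)
    (i3 : A₁ * m₁ ≤ P₁ * T₁) (i5 : A₂ * m₂ ≤ P₂ * T₂)
    (hCI : AM * (m₁₂ - m₃) ≤ PM * (T₁₂ - U₁₂))
    (hL4 : (A₁M * P₁ - A₁ * PM) * (m₃ - m₁₂) ≤ PM * (A₁ * m₂₃ - P₁ * U₁))
    (hL3 : (A₂M * P₂ - A₂ * PM) * (m₃ - m₁₂) ≤ PM * (A₂ * m₁₃ - P₂ * U₂))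
    (hAM : AM = A₁M + A₂M) (hτ1 : m₃ + m₂₃ ≤ m₁ + m₁₂) (hτ2 : m₃ + m₁₃ ≤ m₂ + m₁₂) :
    0 ≤ (T₁₂ - U₁₂) + (T₁ - U₁) + (T₂ - U₂) := by
  have hP1pos : 0 < P₁ := lt_of_lt_of_le hPM hP1
  have hP2pos : 0 < P₂ := lt_of_lt_of_le hPM hP2
  -- relay a₁: P₁ · (PM (T₁ − U₁) − A₁M (m₃ − m₁₂)) ≥ 0
  have e1 : P₁ * (PM * (T₁ - U₁) - A₁M * (m₃ - m₁₂)) =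
      PM * (P₁ * T₁) - PM * (P₁ * U₁) - A₁M * P₁ * (m₃ - m₁₂) := by ring
  have b1 : PM * (A₁ * m₁) ≤ PM * (P₁ * T₁) := mul_le_mul_of_nonneg_left i3 hPM.le
  have c1 : 0 ≤ A₁ * PM * ((m₁ + m₁₂) - (m₃ + m₂₃)) :=
    mul_nonneg (mul_nonneg hA1 hPM.le) (by linarith)
  have k1 : 0 ≤ P₁ * (PM * (T₁ - U₁) - A₁M * (m₃ - m₁₂)) := by
    rw [e1]; nlinarith
  have r1 : 0 ≤ PM * (T₁ - U₁) - A₁M * (m₃ - m₁₂) :=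
    (mul_nonneg_iff_of_pos_left hP1pos).mp k1
  -- relay a₂
  have e2 : P₂ * (PM * (T₂ - U₂) - A₂M * (m₃ - m₁₂)) =
      PM * (P₂ * T₂) - PM * (P₂ * U₂) - A₂M * P₂ * (m₃ - m₁₂) := by ring
  have b2 : PM * (A₂ * m₂) ≤ PM * (P₂ * T₂) := mul_le_mul_of_nonneg_left i5 hPM.le
  have c2 : 0 ≤ A₂ * PM * ((m₂ + m₁₂) - (m₃ + m₁₃)) :=
    mul_nonneg (mul_nonneg hA2 hPM.le) (by linarith)
  have k2 : 0 ≤ P₂ * (PM * (T₂ - U₂) - A₂M * (m₃ - m₁₂)) := by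
    rw [e2]; nlinarith
  have r2 : 0 ≤ PM * (T₂ - U₂) - A₂M * (m₃ - m₁₂) :=
    (mul_nonneg_iff_of_pos_left hP2pos).mp k2
  -- sum
  have ks : 0 ≤ PM * ((T₁₂ - U₁₂) + (T₁ - U₁) + (T₂ - U₂)) := by
    rw [hAM] at hCI; nlinarith
  exact (mul_nonneg_iff_of_pos_left hPM).mp ks

/-- `M = {a₁,a₂,a₃ pairwise separated} ⊆ N₁ = {a₁ ↮ a₂, a₃}`. [folklore] -/
theorem sepAll_subset_N1 (a₁ a₂ a₃ : Fin n) :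
    ((openConn a₁ a₂)ᶜ ∩ (openConn a₁ a₃)ᶜ ∩ (openConn a₂ a₃)ᶜ : Set (BondConfig (Fin n))) ⊆
      (openConn a₁ a₂)ᶜ ∩ (openConn a₁ a₃)ᶜ := Set.inter_subset_left

/-- `M ⊆ N₂ = {a₂ ↮ a₁, a₃}`. [folklore] -/
theorem sepAll_subset_N2 (a₁ a₂ a₃ : Fin n) :
    ((openConn a₁ a₂)ᶜ ∩ (openConn a₁ a₃)ᶜ ∩ (openConn a₂ a₃)ᶜ : Set (BondConfig (Fin n))) ⊆
      (openConn a₂ a₁)ᶜ ∩ (openConn a₂ a₃)ᶜ := by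
  rintro ω ⟨⟨h12, -⟩, h23⟩
  exact ⟨fun h => h12 (SimpleGraph.Reachable.symm h), h23⟩

/-- Under `M`, `{a₁ ↔ o}` and `{a₂ ↔ o}` are disjoint, so `μ(M ∩ ({a₁↔o} ∪ {a₂↔o})) = μ(M ∩ {a₁↔o}) + μ(M ∩ {a₂↔o})`.
[folklore] -/
theorem measureReal_sepAll_inter_union (w : Sym2 (Fin n) → unitInterval) (o a₁ a₂ a₃ : Fin n) :
    (prodBernoulli w).real ((openConn a₁ a₂)ᶜ ∩ (openConn a₁ a₃)ᶜ ∩ (openConn a₂ a₃)ᶜ ∩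
        (openConn a₁ o ∪ openConn a₂ o) : Set (BondConfig (Fin n))) =
      (prodBernoulli w).real ((openConn a₁ a₂)ᶜ ∩ (openConn a₁ a₃)ᶜ ∩ (openConn a₂ a₃)ᶜ ∩
          openConn a₁ o : Set (BondConfig (Fin n))) +
        (prodBernoulli w).real ((openConn a₁ a₂)ᶜ ∩ (openConn a₁ a₃)ᶜ ∩ (openConn a₂ a₃)ᶜ ∩
          openConn a₂ o : Set (BondConfig (Fin n))) := by
  rw [Set.inter_union_distrib_left]
  refine measureReal_union ?_ MeasurableSet.of_discrete
  rw [Set.disjoint_left]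
  rintro ω ⟨⟨⟨h12, -⟩, -⟩, h1o⟩ ⟨-, h2o⟩
  exact h12 (SimpleGraph.Reachable.trans h1o (SimpleGraph.Reachable.symm h2o))

end TOT3Rows

open TOT3Rows

/-- **Kozma–Nitzan Question 7 at three relays from the three factory rows.**  Finite weighted graph on
`Fin n`, observer `o`, sink `b`, pairwise distinct relays `a₁, a₂, a₃` with `a₃` least `b`-reliable
(`μ(a₃↔b) ≤ μ(a₁↔b), μ(a₂↔b)`), `μ(M) > 0` for `M = {a₁,a₂,a₃ pairwise separated}`.  HYPOTHESES `hCI`,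
`hL4`, `hL3` are the conjectured rows (CI-ψ), (L4b), (L3b) of the module docstring, written on the events of
`stub_knThm2GoodSplit`.  CONCLUSION: `μ(o↔A, a₃↔b) ≤ μ(o↔A, o↔b)` (pre-FKG (3) at the least reliable relay,
KN Question 7).  Proof: `stub_knThm2GoodSplit`, two of KN's six set-BHK steps (`knThm2_bhkOne` fed with the
tree theorem `stub_bhkSets`), `knThm2_tau_sub`, and `tot3Rows_arith`.
[cite: KozmaNitzan2024, Theorem 2 (§3.2, pp. 8–9), Question 7 (§5.5, p. 36); VandenbergHaggstromKahn2005, Thm. 1.3 (p. 6)] -/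
theorem knQ7_three_of_tot3Rows (w : Sym2 (Fin n) → unitInterval) (o b a₁ a₂ a₃ : Fin n)
    (h12 : a₁ ≠ a₂) (h13 : a₁ ≠ a₃) (h23 : a₂ ≠ a₃)
    (hτ31 : (prodBernoulli w).real (openConn a₃ b) ≤ (prodBernoulli w).real (openConn a₁ b))
    (hτ32 : (prodBernoulli w).real (openConn a₃ b) ≤ (prodBernoulli w).real (openConn a₂ b))
    (hM : 0 < (prodBernoulli w).real
      ((openConn a₁ a₂)ᶜ ∩ (openConn a₁ a₃)ᶜ ∩ (openConn a₂ a₃)ᶜ : Set (BondConfig (Fin n))))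
    (hCI : (prodBernoulli w).real ((openConn a₁ a₂)ᶜ ∩ (openConn a₁ a₃)ᶜ ∩ (openConn a₂ a₃)ᶜ ∩
              (openConn a₁ o ∪ openConn a₂ o) : Set (BondConfig (Fin n))) *
          ((prodBernoulli w).real ((openConn a₁ a₃)ᶜ ∩ (openConn a₂ a₃)ᶜ ∩ (openConn a₁ b ∩ openConn a₂ b)) -
            (prodBernoulli w).real ((openConn a₁ a₃)ᶜ ∩ (openConn a₂ a₃)ᶜ ∩ openConn a₃ b)) ≤
        (prodBernoulli w).real
            ((openConn a₁ a₂)ᶜ ∩ (openConn a₁ a₃)ᶜ ∩ (openConn a₂ a₃)ᶜ : Set (BondConfig (Fin n))) *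
          ((prodBernoulli w).real ((openConn a₁ a₃)ᶜ ∩ (openConn a₂ a₃)ᶜ ∩
              ((openConn a₁ o ∪ openConn a₂ o) ∩ (openConn a₁ b ∩ openConn a₂ b))) -
            (prodBernoulli w).real ((openConn a₁ a₃)ᶜ ∩ (openConn a₂ a₃)ᶜ ∩
              ((openConn a₁ o ∪ openConn a₂ o) ∩ openConn a₃ b))))
    (hL4 : ((prodBernoulli w).real ((openConn a₁ a₂)ᶜ ∩ (openConn a₁ a₃)ᶜ ∩ (openConn a₂ a₃)ᶜ ∩
                openConn a₁ o : Set (BondConfig (Fin n))) *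
              (prodBernoulli w).real ((openConn a₁ a₂)ᶜ ∩ (openConn a₁ a₃)ᶜ : Set (BondConfig (Fin n))) -
            (prodBernoulli w).real ((openConn a₁ a₂)ᶜ ∩ (openConn a₁ a₃)ᶜ ∩ openConn a₁ o) *
              (prodBernoulli w).real
                ((openConn a₁ a₂)ᶜ ∩ (openConn a₁ a₃)ᶜ ∩ (openConn a₂ a₃)ᶜ : Set (BondConfig (Fin n)))) *
          ((prodBernoulli w).real ((openConn a₁ a₃)ᶜ ∩ (openConn a₂ a₃)ᶜ ∩ openConn a₃ b) -
            (prodBernoulli w).real ((openConn a₁ a₃)ᶜ ∩ (openConn a₂ a₃)ᶜ ∩ (openConn a₁ b ∩ openConn a₂ b))) ≤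
        (prodBernoulli w).real
            ((openConn a₁ a₂)ᶜ ∩ (openConn a₁ a₃)ᶜ ∩ (openConn a₂ a₃)ᶜ : Set (BondConfig (Fin n))) *
          ((prodBernoulli w).real ((openConn a₁ a₂)ᶜ ∩ (openConn a₁ a₃)ᶜ ∩ openConn a₁ o) *
              (prodBernoulli w).real ((openConn a₁ a₂)ᶜ ∩ (openConn a₁ a₃)ᶜ ∩ (openConn a₂ b ∩ openConn a₃ b)) -
            (prodBernoulli w).real ((openConn a₁ a₂)ᶜ ∩ (openConn a₁ a₃)ᶜ : Set (BondConfig (Fin n))) *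
              (prodBernoulli w).real
                ((openConn a₁ a₂)ᶜ ∩ (openConn a₁ a₃)ᶜ ∩ (openConn a₁ o ∩ (openConn a₂ b ∩ openConn a₃ b)))))
    (hL3 : ((prodBernoulli w).real ((openConn a₁ a₂)ᶜ ∩ (openConn a₁ a₃)ᶜ ∩ (openConn a₂ a₃)ᶜ ∩
                openConn a₂ o : Set (BondConfig (Fin n))) *
              (prodBernoulli w).real ((openConn a₂ a₁)ᶜ ∩ (openConn a₂ a₃)ᶜ : Set (BondConfig (Fin n))) -
            (prodBernoulli w).real ((openConn a₂ a₁)ᶜ ∩ (openConn a₂ a₃)ᶜ ∩ openConn a₂ o) *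
              (prodBernoulli w).real
                ((openConn a₁ a₂)ᶜ ∩ (openConn a₁ a₃)ᶜ ∩ (openConn a₂ a₃)ᶜ : Set (BondConfig (Fin n)))) *
          ((prodBernoulli w).real ((openConn a₁ a₃)ᶜ ∩ (openConn a₂ a₃)ᶜ ∩ openConn a₃ b) -
            (prodBernoulli w).real ((openConn a₁ a₃)ᶜ ∩ (openConn a₂ a₃)ᶜ ∩ (openConn a₁ b ∩ openConn a₂ b))) ≤
        (prodBernoulli w).real
            ((openConn a₁ a₂)ᶜ ∩ (openConn a₁ a₃)ᶜ ∩ (openConn a₂ a₃)ᶜ : Set (BondConfig (Fin n))) *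
          ((prodBernoulli w).real ((openConn a₂ a₁)ᶜ ∩ (openConn a₂ a₃)ᶜ ∩ openConn a₂ o) *
              (prodBernoulli w).real ((openConn a₂ a₁)ᶜ ∩ (openConn a₂ a₃)ᶜ ∩ (openConn a₁ b ∩ openConn a₃ b)) -
            (prodBernoulli w).real ((openConn a₂ a₁)ᶜ ∩ (openConn a₂ a₃)ᶜ : Set (BondConfig (Fin n))) *
              (prodBernoulli w).real
                ((openConn a₂ a₁)ᶜ ∩ (openConn a₂ a₃)ᶜ ∩ (openConn a₂ o ∩ (openConn a₁ b ∩ openConn a₃ b))))) :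
    (prodBernoulli w).real ((openConn o a₁ ∪ openConn o a₂ ∪ openConn o a₃) ∩ openConn a₃ b) ≤
      (prodBernoulli w).real ((openConn o a₁ ∪ openConn o a₂ ∪ openConn o a₃) ∩ openConn o b) := by
  -- two of KN's six set-BHK bounds (KN p. 9): `A₁ m₁ ≤ P₁ T₁`, `A₂ m₂ ≤ P₂ T₂`
  have i3 := knThm2_bhkOne stub_bhkSets.1 w {a₁} ({a₂, a₃} : Set (Fin n)) o b (by simp [h12, h13])
  have i5 := knThm2_bhkOne stub_bhkSets.1 w {a₂} ({a₁, a₃} : Set (Fin n)) o b (by simp [h12.symm, h23])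
  rw [knThm2_sep_single_set, Finset.set_biUnion_singleton, Finset.set_biInter_singleton] at i3
  rw [knThm2_sep_single_set, Finset.set_biUnion_singleton, Finset.set_biInter_singleton] at i5
  -- `τ₁ − τ₃`, `τ₂ − τ₃` on the atoms
  have hτ1 := knThm2_tau_sub w b a₁ a₂ a₃
  have hτ2 := knThm2_tau_sub w b a₂ a₁ a₃
  rw [Set.inter_comm (openConn a₂ a₃)ᶜ (openConn a₁ a₃)ᶜ,
    Set.inter_comm (openConn a₂ b) (openConn a₁ b)] at hτ2
  -- `X = (T₁₂ − U₁₂) + (T₁ − U₁) + (T₂ − U₂)`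
  have hX := stub_knThm2GoodSplit n w o b a₁ a₂ a₃
  -- `μ(M) ≤ P₁, P₂` and `A_M = A₁M + A₂M`
  have hP1 : (prodBernoulli w).real
        ((openConn a₁ a₂)ᶜ ∩ (openConn a₁ a₃)ᶜ ∩ (openConn a₂ a₃)ᶜ : Set (BondConfig (Fin n))) ≤
      (prodBernoulli w).real ((openConn a₁ a₂)ᶜ ∩ (openConn a₁ a₃)ᶜ : Set (BondConfig (Fin n))) :=
    measureReal_mono (sepAll_subset_N1 a₁ a₂ a₃)
  have hP2 : (prodBernoulli w).real
        ((openConn a₁ a₂)ᶜ ∩ (openConn a₁ a₃)ᶜ ∩ (openConn a₂ a₃)ᶜ : Set (BondConfig (Fin n))) ≤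
      (prodBernoulli w).real ((openConn a₂ a₁)ᶜ ∩ (openConn a₂ a₃)ᶜ : Set (BondConfig (Fin n))) :=
    measureReal_mono (sepAll_subset_N2 a₁ a₂ a₃)
  have hAM := measureReal_sepAll_inter_union w o a₁ a₂ a₃
  have key := tot3Rows_arith hM hP1 hP2 measureReal_nonneg measureReal_nonneg i3 i5 hCI hL4 hL3 hAM
    (by linarith) (by linarith)
  linarith

/-- **Three-relay event gluing with constant 1 (E-form) from the three factory rows.**  Under the
hypotheses of `knQ7_three_of_tot3Rows`:  `μ({o↔a₁ ∨ o↔a₂ ∨ o↔a₃} ∖ {o↔b}) ≤ μ(a₃ ↮ b)` (the least reliable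
relay's disconnection probability = `max_a μ(a ↮ b)`), i.e. sharp `EG₃` for this `(G, o, A, b)`.
[cite: KozmaNitzan2024, Question 7 (§5.5, p. 36)] -/
theorem eventGluing_three_of_tot3Rows (w : Sym2 (Fin n) → unitInterval) (o b a₁ a₂ a₃ : Fin n)
    (h12 : a₁ ≠ a₂) (h13 : a₁ ≠ a₃) (h23 : a₂ ≠ a₃)
    (hτ31 : (prodBernoulli w).real (openConn a₃ b) ≤ (prodBernoulli w).real (openConn a₁ b))
    (hτ32 : (prodBernoulli w).real (openConn a₃ b) ≤ (prodBernoulli w).real (openConn a₂ b))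
    (hM : 0 < (prodBernoulli w).real
      ((openConn a₁ a₂)ᶜ ∩ (openConn a₁ a₃)ᶜ ∩ (openConn a₂ a₃)ᶜ : Set (BondConfig (Fin n))))
    (hCI : (prodBernoulli w).real ((openConn a₁ a₂)ᶜ ∩ (openConn a₁ a₃)ᶜ ∩ (openConn a₂ a₃)ᶜ ∩
              (openConn a₁ o ∪ openConn a₂ o) : Set (BondConfig (Fin n))) *
          ((prodBernoulli w).real ((openConn a₁ a₃)ᶜ ∩ (openConn a₂ a₃)ᶜ ∩ (openConn a₁ b ∩ openConn a₂ b)) -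
            (prodBernoulli w).real ((openConn a₁ a₃)ᶜ ∩ (openConn a₂ a₃)ᶜ ∩ openConn a₃ b)) ≤
        (prodBernoulli w).real
            ((openConn a₁ a₂)ᶜ ∩ (openConn a₁ a₃)ᶜ ∩ (openConn a₂ a₃)ᶜ : Set (BondConfig (Fin n))) *
          ((prodBernoulli w).real ((openConn a₁ a₃)ᶜ ∩ (openConn a₂ a₃)ᶜ ∩
              ((openConn a₁ o ∪ openConn a₂ o) ∩ (openConn a₁ b ∩ openConn a₂ b))) -
            (prodBernoulli w).real ((openConn a₁ a₃)ᶜ ∩ (openConn a₂ a₃)ᶜ ∩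
              ((openConn a₁ o ∪ openConn a₂ o) ∩ openConn a₃ b))))
    (hL4 : ((prodBernoulli w).real ((openConn a₁ a₂)ᶜ ∩ (openConn a₁ a₃)ᶜ ∩ (openConn a₂ a₃)ᶜ ∩
                openConn a₁ o : Set (BondConfig (Fin n))) *
              (prodBernoulli w).real ((openConn a₁ a₂)ᶜ ∩ (openConn a₁ a₃)ᶜ : Set (BondConfig (Fin n))) -
            (prodBernoulli w).real ((openConn a₁ a₂)ᶜ ∩ (openConn a₁ a₃)ᶜ ∩ openConn a₁ o) *
              (prodBernoulli w).real
                ((openConn a₁ a₂)ᶜ ∩ (openConn a₁ a₃)ᶜ ∩ (openConn a₂ a₃)ᶜ : Set (BondConfig (Fin n)))) *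
          ((prodBernoulli w).real ((openConn a₁ a₃)ᶜ ∩ (openConn a₂ a₃)ᶜ ∩ openConn a₃ b) -
            (prodBernoulli w).real ((openConn a₁ a₃)ᶜ ∩ (openConn a₂ a₃)ᶜ ∩ (openConn a₁ b ∩ openConn a₂ b))) ≤
        (prodBernoulli w).real
            ((openConn a₁ a₂)ᶜ ∩ (openConn a₁ a₃)ᶜ ∩ (openConn a₂ a₃)ᶜ : Set (BondConfig (Fin n))) *
          ((prodBernoulli w).real ((openConn a₁ a₂)ᶜ ∩ (openConn a₁ a₃)ᶜ ∩ openConn a₁ o) *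
              (prodBernoulli w).real ((openConn a₁ a₂)ᶜ ∩ (openConn a₁ a₃)ᶜ ∩ (openConn a₂ b ∩ openConn a₃ b)) -
            (prodBernoulli w).real ((openConn a₁ a₂)ᶜ ∩ (openConn a₁ a₃)ᶜ : Set (BondConfig (Fin n))) *
              (prodBernoulli w).real
                ((openConn a₁ a₂)ᶜ ∩ (openConn a₁ a₃)ᶜ ∩ (openConn a₁ o ∩ (openConn a₂ b ∩ openConn a₃ b)))))
    (hL3 : ((prodBernoulli w).real ((openConn a₁ a₂)ᶜ ∩ (openConn a₁ a₃)ᶜ ∩ (openConn a₂ a₃)ᶜ ∩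
                openConn a₂ o : Set (BondConfig (Fin n))) *
              (prodBernoulli w).real ((openConn a₂ a₁)ᶜ ∩ (openConn a₂ a₃)ᶜ : Set (BondConfig (Fin n))) -
            (prodBernoulli w).real ((openConn a₂ a₁)ᶜ ∩ (openConn a₂ a₃)ᶜ ∩ openConn a₂ o) *
              (prodBernoulli w).real
                ((openConn a₁ a₂)ᶜ ∩ (openConn a₁ a₃)ᶜ ∩ (openConn a₂ a₃)ᶜ : Set (BondConfig (Fin n)))) *
          ((prodBernoulli w).real ((openConn a₁ a₃)ᶜ ∩ (openConn a₂ a₃)ᶜ ∩ openConn a₃ b) -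
            (prodBernoulli w).real ((openConn a₁ a₃)ᶜ ∩ (openConn a₂ a₃)ᶜ ∩ (openConn a₁ b ∩ openConn a₂ b))) ≤
        (prodBernoulli w).real
            ((openConn a₁ a₂)ᶜ ∩ (openConn a₁ a₃)ᶜ ∩ (openConn a₂ a₃)ᶜ : Set (BondConfig (Fin n))) *
          ((prodBernoulli w).real ((openConn a₂ a₁)ᶜ ∩ (openConn a₂ a₃)ᶜ ∩ openConn a₂ o) *
              (prodBernoulli w).real ((openConn a₂ a₁)ᶜ ∩ (openConn a₂ a₃)ᶜ ∩ (openConn a₁ b ∩ openConn a₃ b)) -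
            (prodBernoulli w).real ((openConn a₂ a₁)ᶜ ∩ (openConn a₂ a₃)ᶜ : Set (BondConfig (Fin n))) *
              (prodBernoulli w).real
                ((openConn a₂ a₁)ᶜ ∩ (openConn a₂ a₃)ᶜ ∩ (openConn a₂ o ∩ (openConn a₁ b ∩ openConn a₃ b))))) :
    (prodBernoulli w).real ((openConn o a₁ ∪ openConn o a₂ ∪ openConn o a₃) \ openConn o b) ≤
      (prodBernoulli w).real ((openConn a₃ b)ᶜ : Set (BondConfig (Fin n))) := by
  have hX := knQ7_three_of_tot3Rows w o b a₁ a₂ a₃ h12 h13 h23 hτ31 hτ32 hM hCI hL4 hL3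
  have hm : ∀ s : Set (BondConfig (Fin n)), MeasurableSet s := fun _ => MeasurableSet.of_discrete
  have h1 := measureReal_inter_add_sdiff (μ := prodBernoulli w)
    (s := openConn o a₁ ∪ openConn o a₂ ∪ openConn o a₃) (hm (openConn o b))
  have h2 := measureReal_inter_add_sdiff (μ := prodBernoulli w)
    (s := openConn o a₁ ∪ openConn o a₂ ∪ openConn o a₃) (hm (openConn a₃ b))
  have h3 : (prodBernoulli w).real
      ((openConn o a₁ ∪ openConn o a₂ ∪ openConn o a₃) \ openConn a₃ b) ≤
      (prodBernoulli w).real ((openConn a₃ b)ᶜ : Set (BondConfig (Fin n))) :=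
    measureReal_mono fun ω hω => hω.2
  linarith

end

end Summit.CriticalPhenomena.PercolationContinuityZ3.Theorems
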